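import Literature.AlgebraicGeometry.Resolution.VertexBlowupProjectionSmooth
import Literature.AlgebraicGeometry.Resolution.PointBlowupFibreRings
import Literature.AlgebraicGeometry.Resolution.AlterationsStrong
import Mathlib.AlgebraicGeometry.Fiber
import HarnessLib

/-!
# The blow-up of `ℙ^{d+1}` in the vertex: the fibres of `q : P̃ → ℙ^d` are irreducible curves

Topic: `Literature/AlgebraicGeometry/Resolution`. Fifth scheme-level step of the construction of
de Jong 1996, proof of Lemma 4.11 (p. 68), for ANY blowing up `b : P̃ → ℙ^{d+1}_k` of projective
space in the vertex and its projection `q : P̃ → ℙ^d` (`VertexBlowupProjectionMorphism.lean`):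
the fields `irreducibleSpace_fiber` and `topologicalKrullDim_fiber_le_one` of
`DeJong1996.PointBlowupProjection` — "every fibre `q⁻¹(ℓ)` (the line `ℓ`) is irreducible" and
"has dimension `≤ 1`". PROVED here, for `y ∈ D₊(yᵢ) ⊆ ℙ^d`:

* the scheme-theoretic fibre `q⁻¹(y)` (Mathlib `Scheme.Hom.fiber`) is covered by the open pieces
  cut out by `P̃ ∖ E = b⁻¹(ℙ^{d+1} ∖ {vertex})` and by the charts `Spec k[X][I/Xⱼ]`
  (`DeJong1996.fibreCover`);
* the piece off `E` is homeomorphic to the fibre of the linear projection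
  `pr : ℙ^{d+1} ∖ {vertex} → ℙ^d`, i.e. (on the chart `D₊(xᵢ)`) to the fibre of
  `Spec (k[x]_{(xᵢ)})₀ → Spec (k[y]_{(yᵢ)})₀`, an affine line (`PointBlowupFibreRings.lean`);
  the piece on the chart `Spec k[X][I/Xⱼ]` is homeomorphic to the fibre of
  `Spec k[X][I/Xⱼ] → Spec (k[y]_{(yⱼ)})₀`, an affine line, or empty (`y ∉ D₊(yⱼ)`);
* the piece off `E` meets every non-empty chart piece (the point "`Xⱼ = 1`" of the chart fibre,
  `PointBlowup.evalOne`), so the fibre is irreducible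
  (`Motives.ProjectiveSpace.irreducibleSpace_of_iUnion_eq_univ`) — **`irreducibleSpace_fiber`** — and
  of dimension `≤ 1` (`topologicalKrullDim_le_iSup_openCover`) —
  **`topologicalKrullDim_fiber_le_one`**.

No named facts; no new definitions besides the cover and the evaluation `Xⱼ ↦ 1`.

## Sources

* A. J. de Jong, *Smoothness, semi-stability and alterations*, Publ. Math. IHÉS 83 (1996),
  proof of Lemma 4.11, p. 68. [DeJong1996]
* D. Eisenbud, J. Harris, *3264 and All That* (2016), Prop. 9.11, §9.3.2. [EisenbudHarris2016]
-/

noncomputable section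

open CategoryTheory CategoryTheory.Limits AlgebraicGeometry TopologicalSpace HomogeneousLocalization
  Topology

attribute [local instance] MvPolynomial.gradedAlgebra
  Literature.AlgebraicGeometry.Motives.ProjBaseChange.algebraBase
  Literature.AlgebraicGeometry.Motives.ProjBaseChange.isScalarTower_localization

namespace Literature.AlgebraicGeometry.Resolution

universe u

open Literature.AlgebraicGeometry.Motives (projectiveSpace GeneratingSections)
open Literature.AlgebraicGeometry.Motives.Segre (grading chartι toSpec X_mem frac cst)

/-! ## Algebra: the point `Xᵢ = 1` of a chart fibre -/

namespace PointBlowup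

variable (n : ℕ) (k : Type u) [Field k] (i : Fin (n + 1))

/-- **Evaluation at `Xᵢ = 1`**: `k[X][I/Xᵢ] ≅ k[Y][T] → k[Y] ≅ (k[y]_{(yᵢ)})₀`, `T ↦ 1` — a
retraction of `projRingHom` NOT killing `Xᵢ` (a section of `q` on the chart, off the exceptional
divisor). [folklore] -/
def evalOne : Chart n k i →+* Away (grading (Fin (n + 1)) k) (MvPolynomial.X i) :=
  (awayBaseEquiv n k i).symm.toRingHom.comp
    ((MvPolynomial.eval₂Hom (RingHom.id (Base n k i)) fun _ => 1).comp (polyEquiv n k i).symm.toRingHom)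

/-- `evalOne ∘ projRingHom = id`. [folklore] -/
theorem evalOne_comp_projRingHom :
    (evalOne n k i).comp (projRingHom n k i) = RingHom.id _ := by
  refine RingHom.ext fun a => ?_
  rw [RingHom.comp_apply, projRingHom, RingHom.comp_apply, evalOne, RingHom.comp_apply,
    RingHom.comp_apply]
  simp only [RingEquiv.toRingHom_eq_coe, AlgHom.toRingHom_eq_coe,
    RingHom.coe_coe, polyEquiv_symm_baseHom, MvPolynomial.eval₂Hom_C, RingHom.id_apply,
    RingEquiv.symm_apply_apply]

/-- `evalOne (Xᵢ) = 1`. [folklore] -/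
theorem evalOne_exc : evalOne n k i (exc n k i) = 1 := by
  have h : (polyEquiv n k i).symm (exc n k i) = MvPolynomial.X () := by
    apply (polyEquiv n k i).injective
    rw [RingEquiv.apply_symm_apply, polyEquiv_apply, polyHom_X]
  rw [evalOne, RingHom.comp_apply, RingHom.comp_apply]
  simp only [RingEquiv.toRingHom_eq_coe, RingEquiv.coe_toRingHom, h, MvPolynomial.eval₂Hom_X',
    map_one]

end PointBlowup

/-! ## Topology helpers -/

/-- An empty space has topological Krull dimension `⊥`. [folklore] -/
theorem topologicalKrullDim_of_isEmpty (T : Type*) [TopologicalSpace T] [IsEmpty T] :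
    topologicalKrullDim T = ⊥ := by
  haveI : IsEmpty (IrreducibleCloseds T) :=
    ⟨fun Z => Z.isIrreducible.nonempty.elim fun x _ => isEmptyElim x⟩
  exact Order.krullDim_eq_bot

/-- The fibre of `Spec ρ` followed by an injective `ι` over `ι 𝔭` is the fibre of `Spec ρ` over
`𝔭`, the subspace `comap ρ ⁻¹' {𝔭}`. [folklore] -/
theorem preimage_SpecMap_comp_singleton {A B : Type u} [CommRing A] [CommRing B] (ρ : A →+* B)
    {Y : Scheme.{u}} (ι : Spec (.of A) ⟶ Y) (hι : Function.Injective ι) (p : Spec (.of A)) :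
    (Spec.map (CommRingCat.ofHom ρ) ≫ ι) ⁻¹' {ι p} = PrimeSpectrum.comap ρ ⁻¹' {p} := by
  ext x
  simp only [Set.mem_preimage, Set.mem_singleton_iff, Scheme.Hom.comp_apply, hι.eq_iff]
  rfl

/-- Over a point outside the range of `ι`, the fibre of `g ≫ ι` is empty. [folklore] -/
theorem preimage_comp_singleton_eq_empty {T S Y : Scheme.{u}} (g : T ⟶ S) (ι : S ⟶ Y) {y : Y}
    (hy : y ∉ Set.range ι) : (g ≫ ι) ⁻¹' {y} = ∅ := by
  ext x
  simp only [Set.mem_preimage, Set.mem_singleton_iff, Scheme.Hom.comp_apply, Set.mem_empty_iff_false,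
    iff_false]
  exact fun h => hy ⟨g x, h⟩

namespace DeJong1996

variable {d : ℕ} {k : Type u} [Field k]
variable {P : Scheme.{u}} (b : P ⟶ Proj (grading (Fin (d + 1 + 1)) k)) [IsIntegral P] [IsDominant b]
  (hb : IsBlowup b (vertexIdealSheaf d k))

/-! ## The piece of the fibre on a chart `Spec k[X][I/Xⱼ]` -/

/-- **The fibre of a morphism `g ≫ q` as a pullback of the fibre of `q`** (pullback pasting), as
a homeomorphism onto the subspace `(g ≫ q)⁻¹' {y}`. [folklore] -/
def pullbackFiberιHomeo {T : Scheme.{u}} (g : T ⟶ P) (y : Proj (grading (Fin (d + 1)) k)) :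
    ↥(pullback g ((vertexBlowupProjection b hb).fiberι y)) ≃ₜ
      ↥((g ≫ vertexBlowupProjection b hb) ⁻¹' {y}) :=
  (Scheme.homeoOfIso (pullbackRightPullbackFstIso (vertexBlowupProjection b hb)
    ((Proj (grading (Fin (d + 1)) k)).fromSpecResidueField y) g)).trans
    ((g ≫ vertexBlowupProjection b hb).fiberHomeo y)

/-- **The chart piece of the fibre over `y = D₊(yⱼ)`-point `𝔭` is the fibre of
`Spec k[X][I/Xⱼ] → Spec (k[y]_{(yⱼ)})₀` over `𝔭`.** [folklore] -/
def chartPieceHomeo (j : Fin (d + 1)) (p : Spec (.of (Away (grading (Fin (d + 1)) k) (MvPolynomial.X j)))) :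
    ↥(pullback (vertexChart hb j) ((vertexBlowupProjection b hb).fiberι (chartι k j p))) ≃ₜ
      ↥(PrimeSpectrum.comap (PointBlowup.projRingHom d k j) ⁻¹' {p}) :=
  (pullbackFiberιHomeo b hb (vertexChart hb j) (chartι k j p)).trans (Homeomorph.setCongr (by
    rw [vertexChart_comp_vertexBlowupProjection]
    exact preimage_SpecMap_comp_singleton _ _ (chartι k j).isOpenEmbedding.injective p))

/-- The chart piece over a point of `D₊(yⱼ)` is irreducible. [folklore] -/
theorem irreducibleSpace_chartPiece (j : Fin (d + 1))
    (p : Spec (.of (Away (grading (Fin (d + 1)) k) (MvPolynomial.X j)))) :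
    IrreducibleSpace ↥(pullback (vertexChart hb j) ((vertexBlowupProjection b hb).fiberι (chartι k j p))) := by
  rw [(chartPieceHomeo b hb j p).irreducibleSpace_iff]
  exact isIrreducible_iff_irreducibleSpace.mp (PointBlowup.isIrreducible_fibre_projRingHom d k j p).1

/-- The chart piece over a point of `D₊(yⱼ)` has dimension `1`. [folklore] -/
theorem topologicalKrullDim_chartPiece (j : Fin (d + 1))
    (p : Spec (.of (Away (grading (Fin (d + 1)) k) (MvPolynomial.X j)))) :
    topologicalKrullDim ↥(pullback (vertexChart hb j) ((vertexBlowupProjection b hb).fiberι (chartι k j p))) = 1 := by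
  rw [IsHomeomorph.topologicalKrullDim_eq _ (chartPieceHomeo b hb j p).isHomeomorph]
  exact (PointBlowup.isIrreducible_fibre_projRingHom d k j p).2

/-- The chart piece over a point outside `D₊(yⱼ)` is empty. [folklore] -/
theorem isEmpty_chartPiece (j : Fin (d + 1)) {y : Proj (grading (Fin (d + 1)) k)}
    (hy : y ∉ Set.range (chartι k j)) :
    IsEmpty ↥(pullback (vertexChart hb j) ((vertexBlowupProjection b hb).fiberι y)) := by
  have h : (vertexChart hb j ≫ vertexBlowupProjection b hb) ⁻¹' {y} = ∅ := by
    rw [vertexChart_comp_vertexBlowupProjection]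
    exact preimage_comp_singleton_eq_empty _ _ hy
  have e := pullbackFiberιHomeo b hb (vertexChart hb j) y
  rw [h] at e
  exact e.toEquiv.isEmpty

/-- Every chart piece has dimension `≤ 1`. [folklore] -/
theorem topologicalKrullDim_chartPiece_le (j : Fin (d + 1)) (y : Proj (grading (Fin (d + 1)) k)) :
    topologicalKrullDim ↥(pullback (vertexChart hb j) ((vertexBlowupProjection b hb).fiberι y)) ≤ 1 := by
  by_cases hy : y ∈ Set.range (chartι k j)
  · obtain ⟨p, rfl⟩ := hy
    exact (topologicalKrullDim_chartPiece b hb j p).le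
  · haveI := isEmpty_chartPiece b hb j hy
    rw [topologicalKrullDim_of_isEmpty]
    exact bot_le

/-! ## The piece of the fibre off the exceptional divisor -/

/-- The fibre of the linear projection `pr : ℙ^{d+1} ∖ {vertex} → ℙ^d` over a point of `D₊(yᵢ)`
lies in the chart `Spec (k[x]_{(xᵢ)})₀ → ℙ^{d+1} ∖ {vertex}`. [folklore] -/
theorem preimage_vertexProjection_subset_range (i : Fin (d + 1))
    (p : Spec (.of (Away (grading (Fin (d + 1)) k) (MvPolynomial.X i)))) :
    (vertexProjection d k) ⁻¹' {chartι k i p} ⊆ Set.range (chartToPunctured d k i) := by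
  intro w hw
  have hw' : w ∈ vertexProjection d k ⁻¹ᵁ Proj.basicOpen (grading (Fin (d + 1)) k) (MvPolynomial.X i) := by
    change vertexProjection d k w ∈ Proj.basicOpen (grading (Fin (d + 1)) k) (MvPolynomial.X i)
    rw [show vertexProjection d k w = chartι k i p from hw, ← Proj.opensRange_awayι _ _ (X_mem k i) zero_lt_one]
    exact ⟨p, rfl⟩
  rw [vertexProjection_preimage_basicOpen] at hw'
  have hw'' : (puncturedSpace d k).ι w ∈ Set.range (chartι k (Fin.castSucc i)) := by
    rw [← Scheme.Hom.coe_opensRange, Proj.opensRange_awayι]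
    exact hw'
  obtain ⟨s, hs⟩ := hw''
  refine ⟨s, (puncturedSpace d k).ι.isOpenEmbedding.injective ?_⟩
  rw [← Scheme.Hom.comp_apply, chartToPunctured_ι]
  exact hs

/-- **The fibre of `pr : ℙ^{d+1} ∖ {vertex} → ℙ^d` over a `D₊(yᵢ)`-point `𝔭` is the fibre of
`Spec (k[x]_{(xᵢ)})₀ → Spec (k[y]_{(yᵢ)})₀` over `𝔭`.** [folklore] -/
def vertexProjectionFibreHomeo (i : Fin (d + 1))
    (p : Spec (.of (Away (grading (Fin (d + 1)) k) (MvPolynomial.X i)))) :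
    ↥((vertexProjection d k) ⁻¹' {chartι k i p}) ≃ₜ
      ↥(PrimeSpectrum.comap (vertexProjectionRingHom d k i) ⁻¹' {p}) :=
  ((chartToPunctured d k i).isOpenEmbedding.isEmbedding.homeomorphOfSubsetRange
    (preimage_vertexProjection_subset_range i p)).symm.trans (Homeomorph.setCongr (by
      ext w
      simp only [Set.mem_preimage, Set.mem_singleton_iff]
      rw [← Scheme.Hom.comp_apply, chartToPunctured_comp_vertexProjection, vertexProjectionChart,
        Scheme.Hom.comp_apply, (chartι k i).isOpenEmbedding.injective.eq_iff]
      rfl))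

/-- `b` restricted over the punctured space, as a homeomorphism. [folklore] -/
def restrictHomeo : ↥(b ⁻¹ᵁ puncturedSpace d k) ≃ₜ ↥(puncturedSpace d k) :=
  haveI := isIso_morphismRestrict_puncturedSpace hb
  Scheme.homeoOfIso (asIso (b ∣_ puncturedSpace d k))

omit [IsIntegral P] [IsDominant b] in
/-- `restrictHomeo` is `b|` on points. [folklore] -/
theorem restrictHomeo_apply (x : ↥(b ⁻¹ᵁ puncturedSpace d k)) :
    restrictHomeo b hb x = (b ∣_ puncturedSpace d k) x :=
  rfl

/-- **The piece of the fibre off `E` over a `D₊(yᵢ)`-point `𝔭` is the fibre of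
`Spec (k[x]_{(xᵢ)})₀ → Spec (k[y]_{(yᵢ)})₀` over `𝔭`** (through `b| : P̃ ∖ E ≅ ℙ^{d+1} ∖ {vertex}`
and `q = pr ∘ b` there). [folklore] -/
def offPieceHomeo (i : Fin (d + 1)) (p : Spec (.of (Away (grading (Fin (d + 1)) k) (MvPolynomial.X i)))) :
    ↥(pullback (b ⁻¹ᵁ puncturedSpace d k).ι ((vertexBlowupProjection b hb).fiberι (chartι k i p))) ≃ₜ
      ↥(PrimeSpectrum.comap (vertexProjectionRingHom d k i) ⁻¹' {p}) := by
  refine (pullbackFiberιHomeo b hb (b ⁻¹ᵁ puncturedSpace d k).ι (chartι k i p)).trans ?_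
  refine (Homeomorph.setCongr ?_).trans
    (((restrictHomeo b hb).isEmbedding.homeomorphOfSubsetRange
      (s := (vertexProjection d k) ⁻¹' {chartι k i p}) ?_).trans (vertexProjectionFibreHomeo i p))
  · rw [(isVertexProjection_vertexBlowupProjection b hb).preimage_ι_comp d k]
    ext w
    simp only [Set.mem_preimage, Set.mem_singleton_iff, Scheme.Hom.comp_apply]
    rfl
  · rw [(restrictHomeo b hb).range_coe]
    exact Set.subset_univ _

/-- The piece off `E` is irreducible. [folklore] -/
theorem irreducibleSpace_offPiece (i : Fin (d + 1))
    (p : Spec (.of (Away (grading (Fin (d + 1)) k) (MvPolynomial.X i)))) :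
    IrreducibleSpace ↥(pullback (b ⁻¹ᵁ puncturedSpace d k).ι
      ((vertexBlowupProjection b hb).fiberι (chartι k i p))) := by
  rw [(offPieceHomeo b hb i p).irreducibleSpace_iff]
  exact isIrreducible_iff_irreducibleSpace.mp (isIrreducible_fibre_vertexProjectionRingHom d k i p).1

/-- The piece off `E` has dimension `1`. [folklore] -/
theorem topologicalKrullDim_offPiece (i : Fin (d + 1))
    (p : Spec (.of (Away (grading (Fin (d + 1)) k) (MvPolynomial.X i)))) :
    topologicalKrullDim ↥(pullback (b ⁻¹ᵁ puncturedSpace d k).ι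
      ((vertexBlowupProjection b hb).fiberι (chartι k i p))) = 1 := by
  rw [IsHomeomorph.topologicalKrullDim_eq _ (offPieceHomeo b hb i p).isHomeomorph]
  exact (isIrreducible_fibre_vertexProjectionRingHom d k i p).2

/-! ## The hub point: the chart fibre meets the complement of `E` -/

omit [IsIntegral P] [IsDominant b] in
/-- If the chart point `𝔮` of `Spec k[X][I/Xⱼ]` maps to the vertex under `b`, then `Xⱼ ∈ 𝔮`
(it lies on the exceptional divisor `V(Xⱼ)`). [folklore] -/
theorem exc_mem_of_apply_vertexChart_eq (j : Fin (d + 1)) (q : Spec (.of (PointBlowup.Chart d k j)))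
    (hq : b (vertexChart hb j q) = vertex d k) : PointBlowup.exc d k j ∈ q.asIdeal := by
  let r := Spec.map (CommRingCat.ofHom (toChart d k j)) q
  have hbr : b (vertexChart hb j q) = (lastChart d k).2.fromSpec r := by
    rw [← Scheme.Hom.comp_apply, vertexChart_comp hb j, Scheme.Hom.comp_apply]
  have hv : vertex d k ∈ ((vertexIdealSheaf d k).support : Set _) := by
    rw [vertexIdealSheaf, Scheme.IdealSheafData.coe_support_vanishingIdeal]
    exact Set.mem_singleton _
  have hz := (Scheme.IdealSheafData.mem_support_iff_of_mem (I := vertexIdealSheaf d k)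
    (U := lastChart d k) (vertex_mem_lastChart d k)).mp hv
  have hz' : (lastChart d k).2.fromSpec r ∈
      (Proj (grading (Fin (d + 1 + 1)) k)).zeroLocus (U := lastChart d k)
        ((vertexIdealSheaf d k).ideal (lastChart d k)) ∩ (lastChart d k : (Proj (grading (Fin (d + 1 + 1)) k)).Opens) := by
    rw [← hbr, hq]
    exact ⟨hz, vertex_mem_lastChart d k⟩
  rw [← (lastChart d k).2.fromSpec_image_zeroLocus] at hz'
  obtain ⟨r', hr', hrr'⟩ := hz'
  have hinj : r' = r := (lastChart d k).2.fromSpec.isOpenEmbedding.injective hrr'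
  subst hinj
  have hmem : vertexSection d k j ∈ (Spec.map (CommRingCat.ofHom (toChart d k j)) q).asIdeal :=
    (PrimeSpectrum.mem_zeroLocus _ _).mp hr' (vertexSection_mem d k j)
  change vertexSection d k j ∈ Ideal.comap (toChart d k j) q.asIdeal at hmem
  rw [Ideal.mem_comap, toChart_vertexSection, PointBlowup.frac_self, mul_one] at hmem
  exact hmem

/-- **The hub point**: over a `D₊(yⱼ)`-point `𝔭`, the point "`Xⱼ = 1`" of the chart
`Spec k[X][I/Xⱼ]` lies in the fibre `q⁻¹(y)`, in the chart, and off the exceptional divisor.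
[folklore] -/
theorem exists_hubPoint (j : Fin (d + 1)) (p : Spec (.of (Away (grading (Fin (d + 1)) k) (MvPolynomial.X j)))) :
    ∃ x : P, vertexBlowupProjection b hb x = chartι k j p ∧ x ∈ Set.range (vertexChart hb j) ∧
      b x ∈ puncturedSpace d k := by
  let q₁ : Spec (.of (PointBlowup.Chart d k j)) := Spec.map (CommRingCat.ofHom (PointBlowup.evalOne d k j)) p
  refine ⟨vertexChart hb j q₁, ?_, ⟨q₁, rfl⟩, ?_⟩
  · rw [← Scheme.Hom.comp_apply, ← Scheme.Hom.comp_apply,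
      vertexChart_comp_vertexBlowupProjection, ← Spec.map_comp_assoc, ← CommRingCat.ofHom_comp,
      PointBlowup.evalOne_comp_projRingHom, CommRingCat.ofHom_id, Spec.map_id, Category.id_comp]
  · rw [mem_puncturedSpace_iff]
    intro h
    have hmem := exc_mem_of_apply_vertexChart_eq b hb j q₁ h
    change PointBlowup.exc d k j ∈ Ideal.comap (PointBlowup.evalOne d k j) p.asIdeal at hmem
    rw [Ideal.mem_comap, PointBlowup.evalOne_exc] at hmem
    exact p.2.ne_top ((Ideal.eq_top_iff_one _).mpr hmem)

/-! ## The cover of the fibre and the conclusions -/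

/-- **The open cover of the fibre `q⁻¹(y)`** by its pieces off `E` and on the charts
`Spec k[X][I/Xⱼ]` (the pull-back of `blowupCover`). [folklore] -/
def fibreCover (y : Proj (grading (Fin (d + 1)) k)) : ((vertexBlowupProjection b hb).fiber y).OpenCover :=
  Scheme.Cover.mkOfCovers (Option (Fin (d + 1)))
    (fun o => pullback ((blowupCover b hb).f o) ((vertexBlowupProjection b hb).fiberι y))
    (fun o => pullback.snd _ _)
    (fun f => by
      let o := (blowupCover b hb).idx ((vertexBlowupProjection b hb).fiberι y f)
      obtain ⟨x', hx'⟩ := (blowupCover b hb).covers ((vertexBlowupProjection b hb).fiberι y f)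
      have hf : f ∈ Set.range (pullback.snd ((blowupCover b hb).f o) ((vertexBlowupProjection b hb).fiberι y)) := by
        rw [Scheme.Pullback.range_snd]
        exact ⟨x', hx'⟩
      obtain ⟨z, hz⟩ := hf
      exact ⟨o, z, hz⟩)

omit [IsIntegral P] [IsDominant b] in
/-- The maps of `blowupCover`. [folklore] -/
theorem blowupCover_f_none : (blowupCover b hb).f none = (b ⁻¹ᵁ puncturedSpace d k).ι := rfl

omit [IsIntegral P] [IsDominant b] in
/-- The maps of `blowupCover`. [folklore] -/
theorem blowupCover_f_some (j : Fin (d + 1)) : (blowupCover b hb).f (some j) = vertexChart hb j := rfl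

/-- **Every fibre of `q` has dimension `≤ 1`.** [cite: DeJong1996, Lemma 4.11 (proof), p. 68] -/
theorem topologicalKrullDim_fiber_le_one (y : Proj (grading (Fin (d + 1)) k)) :
    topologicalKrullDim ↥((vertexBlowupProjection b hb).fiber y) ≤ 1 := by
  obtain ⟨i, hi⟩ := (GeneratingSections.ofHom (𝟙 (Proj (grading (Fin (d + 1)) k)))).exists_mem_U y
  change y ∈ Proj.basicOpen (grading (Fin (d + 1)) k) (MvPolynomial.X i) at hi
  rw [← Proj.opensRange_awayι _ _ (X_mem k i) zero_lt_one] at hi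
  obtain ⟨p, rfl⟩ := hi
  refine (topologicalKrullDim_le_iSup_openCover (fibreCover b hb (chartι k i p))).trans (iSup_le fun o => ?_)
  cases o with
  | none =>
    show topologicalKrullDim ↥(pullback (b ⁻¹ᵁ puncturedSpace d k).ι
      ((vertexBlowupProjection b hb).fiberι (chartι k i p))) ≤ 1
    exact (topologicalKrullDim_offPiece b hb i p).le
  | some j =>
    show topologicalKrullDim ↥(pullback (vertexChart hb j)
      ((vertexBlowupProjection b hb).fiberι (chartι k i p))) ≤ 1
    exact topologicalKrullDim_chartPiece_le b hb j _

/-- **Every fibre of `q` is irreducible.** [cite: DeJong1996, Lemma 4.11 (proof), p. 68] -/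
theorem irreducibleSpace_fiber (y : Proj (grading (Fin (d + 1)) k)) :
    IrreducibleSpace ↥((vertexBlowupProjection b hb).fiber y) := by
  obtain ⟨i, hi⟩ := (GeneratingSections.ofHom (𝟙 (Proj (grading (Fin (d + 1)) k)))).exists_mem_U y
  change y ∈ Proj.basicOpen (grading (Fin (d + 1)) k) (MvPolynomial.X i) at hi
  rw [← Proj.opensRange_awayι _ _ (X_mem k i) zero_lt_one] at hi
  obtain ⟨p, rfl⟩ := hi
  -- the fibre scheme, its cover, and the index set of the non-empty pieces
  let q := vertexBlowupProjection b hb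
  let 𝒱 := fibreCover b hb (chartι k i p)
  let J := {o : Option (Fin (d + 1)) // o = none ∨ ∃ j, o = some j ∧ chartι k i p ∈ Set.range (chartι k j)}
  have hopen : ∀ o, IsOpen (Set.range (𝒱.f o)) := fun o => (𝒱.f o).isOpenEmbedding.isOpen_range
  -- every point of the fibre lies in a non-empty piece
  have hcov : ⋃ o : J, Set.range (𝒱.f o.1) = Set.univ := by
    refine Set.eq_univ_of_forall fun f => ?_
    obtain ⟨z, hz⟩ := 𝒱.covers f
    refine Set.mem_iUnion.mpr ⟨⟨𝒱.idx f, ?_⟩, z, hz⟩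
    rcases h𝒾 : 𝒱.idx f with _ | j
    · exact Or.inl rfl
    · refine Or.inr ⟨j, rfl, ?_⟩
      by_contra hy
      haveI := isEmpty_chartPiece b hb j hy
      have z' : ↥(pullback ((blowupCover b hb).f (some j)) (q.fiberι (chartι k i p))) := h𝒾 ▸ z
      exact isEmptyElim (α := ↥(pullback (vertexChart hb j) (q.fiberι (chartι k i p)))) z'
  -- the pieces are irreducible
  have hirr : ∀ o : J, IsIrreducible (Set.range (𝒱.f o.1)) := by
    rintro ⟨o, ho⟩
    rcases ho with rfl | ⟨j, rfl, ⟨p', hp'⟩⟩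
    · haveI := irreducibleSpace_offPiece b hb i p
      have := (IrreducibleSpace.isIrreducible_univ
        ↥(pullback (b ⁻¹ᵁ puncturedSpace d k).ι (q.fiberι (chartι k i p)))).image _
        (𝒱.f none).continuous.continuousOn
      rwa [Set.image_univ] at this
    · have hI := irreducibleSpace_chartPiece b hb j p'
      rw [hp'] at hI
      have := (IrreducibleSpace.isIrreducible_univ
        ↥(pullback (vertexChart hb j) (q.fiberι (chartι k i p)))).image _
        (𝒱.f (some j)).continuous.continuousOn
      rwa [Set.image_univ] at this
  -- the piece off `E` meets every non-empty piece
  have hne : ∀ o : J, (Set.range (𝒱.f o.1) ∩ Set.range (𝒱.f (⟨none, Or.inl rfl⟩ : J).1)).Nonempty := by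
    rintro ⟨o, ho⟩
    rcases ho with rfl | ⟨j, rfl, ⟨p', hp'⟩⟩
    · rw [Set.inter_self]
      exact (hirr ⟨none, Or.inl rfl⟩).nonempty
    · obtain ⟨x, hx, hxr, hxb⟩ := exists_hubPoint b hb j p'
      rw [hp'] at hx
      have hxf : x ∈ Set.range (q.fiberι (chartι k i p)) := by
        rw [Scheme.Hom.range_fiberι]
        exact hx
      obtain ⟨f, rfl⟩ := hxf
      refine ⟨f, ?_, ?_⟩
      · change f ∈ Set.range (pullback.snd ((blowupCover b hb).f (some j)) (q.fiberι (chartι k i p)))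
        rw [Scheme.Pullback.range_snd]
        exact hxr
      · change f ∈ Set.range (pullback.snd ((blowupCover b hb).f none) (q.fiberι (chartι k i p)))
        rw [Scheme.Pullback.range_snd]
        exact ⟨⟨q.fiberι _ f, hxb⟩, rfl⟩
  exact Motives.ProjectiveSpace.irreducibleSpace_of_iUnion_eq_univ (fun o : J => Set.range (𝒱.f o.1)) hcov
    (fun o => hopen o.1) hirr ⟨none, Or.inl rfl⟩ hne

end DeJong1996

end Literature.AlgebraicGeometry.Resolution

end
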